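import Literature.NumberTheory.EllipticCurves.ModularSymbolsRationalPeriodsProofs
import Literature.NumberTheory.EllipticCurves.ModularCurveGenusIntegralityProofs
import HarnessLib

/-!
# `[r]⁻_f ∈ ℚ · Ω⁻_f`, `Ω⁻_f ≠ 0` for rational newforms: reduction to the existence of
# `g(X₀(N))` cusp forms, and the unconditional levels `g(X₀(N)) ≤ 1`
# (provefact `Literature.NumberTheory.EllipticCurves.ModularForms.IsNewform0.exists_rat_smul_minusPeriod`)

D-0014 keeps `Literature/` sorry-free by stating cited results as named facts `def X : Prop`.
The named fact `IsNewform0.exists_rat_smul_minusPeriod` of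
`Literature.NumberTheory.EllipticCurves.ModularSymbols` says (Manin 1972, Thm. 3.5 with the
remark before Cor. 3.6, p. 35 of the translation: "if the eigenvalues of `T_m` on `Φ` are rational,
the arguments of all the parabolic points of `X_N(ℂ)` are *rational* linear combinations of the
fundamental periods"; Cor. 3.6; with Eichler–Shimura for `Ω⁻_f ≠ 0`): for a normalised newform
`f ∈ S₂(Γ₀(N))` with rational coefficients, `Ω⁻_f ≠ 0` and `im (minusSymbol f r) ∈ ℚ · Ω⁻_f` for
every `r ∈ ℚ`.

State of the discharge (this cluster of files):

* Manin–Drinfeld for rational newforms is a theorem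
  (`exists_nsmul_modularSymbol_mem_periodLattice_of_isNewform0`,
  `ModularSymbolsManinDrinfeldProofs`), as are the conjugation-stability of `Λ_f`
  (`conj_mem_periodLattice_holds`), Manin's presentation and rank bound
  (`ModularSymbolsManin`), the counts `ε₂ = ν₂`, `ε₃ = ν₃`, `ε_∞ = ν_∞`, `[SL₂(ℤ) : Γ₀(N)] = μ`
  and the integrality `12 ∣ 12 + μ - 3ν₂ - 4ν₃ - 6ν_∞` of the genus formula
  (`twelve_mul_genusX0_holds`, `ModularCurveGenusIntegralityProofs`);
* so the fact is reduced (`IsNewform0.exists_rat_smul_minusPeriod_of_genus`,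
  `ModularSymbolsRationalPeriodsProofs`) to the genus-cum-dimension formula
  `twelve_mul_finrank_cuspForm_two (Gamma0 N)`, of which exactly the existence half remains:
  **`genusX0 N ≤ dim_ℂ S₂(Γ₀(N))`**, the existence of `g(X₀(N))` linearly independent weight-`2`
  cusp forms on `Γ₀(N)` (holomorphic differentials on `X₀(N)`: Riemann–Roch / Hodge theory,
  Diamond–Shurman Thm. 3.5.1 with §3.3, Cor. 3.4.2; Shimura 1971, Thm. 2.23), the named fact
  `finrank_cuspForm_two_eq_genusX0 N` of `ModularCurve` in its equivalent form
  `finrank_cuspForm_two_eq_genusX0_iff_le`.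

This file records that reduction in its final form and the levels where it is unconditional:

* `IsNewform0.exists_rat_smul_minusPeriod_of_genusX0_le`: the fact at level `N` from
  `genusX0 N ≤ dim_ℂ S₂(Γ₀(N))` alone;
* `IsNewform0.exists_rat_smul_minusPeriod_of_finrank_eq_genusX0`: the same from the named fact
  `finrank_cuspForm_two_eq_genusX0 N` (`dim_ℂ S₂(Γ₀(N)) = genusX0 N`) — the shape of the final
  discharge `…_holds := …_of_finrank_eq_genusX0 (finrank_cuspForm_two_eq_genusX0_holds N)`;
* `twelve_mul_finrank_cuspForm_two_gamma0_of_genusX0_le_one`: for `g(X₀(N)) ≤ 1` the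
  genus-cum-dimension formula holds as soon as `S₂(Γ₀(N)) ≠ 0` — and a newform is itself a nonzero
  weight-`2` cusp form (`IsNewform0.ne_zero`), so
* `finrank_cuspForm_two_eq_genusX0_of_genusX0_le_one`,
  `IsNewform0.finrank_cuspForm_two_eq_genusX0_of_genusX0_le_one`,
  `IsNewform0.twelve_mul_finrank_cuspForm_two_of_genusX0_le_one`: at such levels a nonzero cusp
  form — e.g. the newform of the hypothesis `IsNewform0 f` — yields both dimension facts, so that
  every fact of the cluster conditional on them is unconditional there under its own hypothesis;
* `IsNewform0.exists_rat_smul_minusPeriod_of_genusX0_le_one`: **the fact holds outright at every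
  level `N` with `genusX0 N ≤ 1`**, in particular (`genusX0_le_one_of_mem`, from the classical data
  `μ, ν₂, ν₃, ν_∞`, Diamond–Shurman §3.9 Figure 3.3 and Ex. 3.1.4) at the twenty-seven levels
  `N ∈ {1, …, 21, 24, 25, 27, 32, 36, 49}` of genus `≤ 1`
  (`IsNewform0.exists_rat_smul_minusPeriod_of_mem`), which include the twelve genus-one levels
  `11, 14, 15, 17, 19, 20, 21, 24, 27, 32, 36, 49` carrying the first rational newforms
  (Cremona 1997, Table 1).

The general level needs `genusX0 N ≤ dim_ℂ S₂(Γ₀(N))` and nothing else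
(`IsNewform0.exists_rat_smul_minusPeriod_of_genusX0_le`).

## References

* Ju. I. Manin, *Parabolic points and zeta functions of modular curves*, Izv. Akad. Nauk SSSR
  Ser. Mat. 36 (1972), 19–66; Engl. transl. Math. USSR-Izv. 6 (1972), 19–64,
  doi:10.1070/IM1972v006n01ABEH001867: Prop. 1.4, Thm. 1.9, Thm. 3.5 (22) and p. 35, Cor. 3.6.
* J. E. Cremona, *Algorithms for modular elliptic curves*, 2nd ed., CUP 1997, §2.8, Table 1.
* F. Diamond, J. Shurman, *A first course in modular forms*, GTM 228, Springer 2005, Thm. 3.1.1,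
  Ex. 3.1.4, Thm. 3.5.1, §3.9 (Figure 3.3).
-/

noncomputable section

open scoped MatrixGroups ModularForm

open CongruenceSubgroup Module

namespace Literature.NumberTheory.EllipticCurves.ModularForms

/-! ### The reduction in final form -/

section Reduction

variable {N : ℕ} [NeZero N] {f : CuspForm (Gamma0 N) 2}

/-- **`IsNewform0.exists_rat_smul_minusPeriod` from the existence of `g(X₀(N))` weight-`2` cusp
forms alone**: if `genusX0 N ≤ dim_ℂ S₂(Γ₀(N))` (the Riemann–Roch half of Diamond–Shurman
Thm. 3.5.1, `k = 2`; the other half `dim ≤ g` is Manin's bound `finrank_cuspForm_two_le_genusX0`),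
then for every normalised newform `f ∈ S₂(Γ₀(N))` with rational coefficients `Ω⁻_f ≠ 0` and
`im (minusSymbol f r) ∈ ℚ · Ω⁻_f` (Manin 1972, Thm. 3.5 and Cor. 3.6; the integrality of the genus
formula, `twelve_mul_genusX0_holds`, turns the hypothesis into
`twelve_mul_finrank_cuspForm_two (Gamma0 N)` for `IsNewform0.exists_rat_smul_minusPeriod_of_genus`).
[cite: Manin1972, Thm. 3.5 and Cor. 3.6] -/
theorem IsNewform0.exists_rat_smul_minusPeriod_of_genusX0_le
    (h : genusX0 N ≤ finrank ℂ (CuspForm (Gamma0 N) 2)) :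
    IsNewform0.exists_rat_smul_minusPeriod (f := f) :=
  IsNewform0.exists_rat_smul_minusPeriod_of_genus
    ((twelve_mul_finrank_cuspForm_two_gamma0_iff N).mpr
      ((finrank_cuspForm_two_eq_genusX0_iff_le N).mpr h))

/-- **`IsNewform0.exists_rat_smul_minusPeriod` from the dimension formula
`dim_ℂ S₂(Γ₀(N)) = g(X₀(N))`** (the named fact `finrank_cuspForm_two_eq_genusX0 N` of
`ModularCurve`, Diamond–Shurman Thm. 3.5.1): the shape of the final discharge —
`IsNewform0.exists_rat_smul_minusPeriod_holds` is this theorem applied to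
`finrank_cuspForm_two_eq_genusX0_holds N` once that fact is a theorem
(Manin 1972, Thm. 3.5 and Cor. 3.6). [cite: Manin1972, Thm. 3.5 and Cor. 3.6] -/
theorem IsNewform0.exists_rat_smul_minusPeriod_of_finrank_eq_genusX0
    (h : finrank_cuspForm_two_eq_genusX0 N) :
    IsNewform0.exists_rat_smul_minusPeriod (f := f) :=
  IsNewform0.exists_rat_smul_minusPeriod_of_genusX0_le
    ((finrank_cuspForm_two_eq_genusX0_iff_le N).mp h)

/-- **The genus-cum-dimension formula at a level of genus `≤ 1` carrying a nonzero weight-`2`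
cusp form**: if `genusX0 N ≤ 1` and `S₂(Γ₀(N)) ≠ 0` then
`12 dim S₂(Γ₀(N)) + 3ε₂ + 4ε₃ + 6ε_∞ = 12 + μ` (`twelve_mul_finrank_cuspForm_two (Gamma0 N)`):
`dim ≥ 1 ≥ g` supplies the existence half (Diamond–Shurman Thm. 3.5.1 with Thm. 3.1.1).
[cite: DiamondShurman2005, Thm. 3.5.1 with Thm. 3.1.1] -/
theorem twelve_mul_finrank_cuspForm_two_gamma0_of_genusX0_le_one (hg : genusX0 N ≤ 1)
    {φ : CuspForm (Gamma0 N) 2} (hφ : φ ≠ 0) : twelve_mul_finrank_cuspForm_two (Gamma0 N) := by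
  refine (twelve_mul_finrank_cuspForm_two_gamma0_iff N).mpr
    ((finrank_cuspForm_two_eq_genusX0_iff_le N).mpr (hg.trans ?_))
  rw [Nat.one_le_iff_ne_zero, Ne, finrank_zero_iff_forall_zero, not_forall]
  exact ⟨φ, hφ⟩

/-- **`dim S₂(Γ₀(N)) = g(X₀(N))` at a level of genus `≤ 1` carrying a nonzero weight-`2` cusp
form** (the named fact `finrank_cuspForm_two_eq_genusX0 N` of `ModularCurve`, Diamond–Shurman
Thm. 3.5.1, at such levels): with `φ ≠ 0`, `g ≤ 1 ≤ dim ≤ g` (Manin's bound) forces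
`dim = g = 1`. [cite: DiamondShurman2005, Thm. 3.5.1] -/
theorem finrank_cuspForm_two_eq_genusX0_of_genusX0_le_one (hg : genusX0 N ≤ 1)
    {φ : CuspForm (Gamma0 N) 2} (hφ : φ ≠ 0) : finrank_cuspForm_two_eq_genusX0 N :=
  (twelve_mul_finrank_cuspForm_two_gamma0_iff N).mp
    (twelve_mul_finrank_cuspForm_two_gamma0_of_genusX0_le_one hg hφ)

/-- **A rational or irrational newform at a level of genus `≤ 1` witnesses the dimension formula
there**: `IsNewform0 f` gives `f ≠ 0` (`a₁(f) = 1`), hence `finrank_cuspForm_two_eq_genusX0 N`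
when `genusX0 N ≤ 1` — the form in which the genus-`≤ 1` case of every fact of this cluster
conditional on `twelve_mul_finrank_cuspForm_two (Gamma0 N)` / `finrank_cuspForm_two_eq_genusX0 N`
becomes unconditional under its own hypothesis `IsNewform0 f`.
[cite: DiamondShurman2005, Thm. 3.5.1] -/
theorem IsNewform0.finrank_cuspForm_two_eq_genusX0_of_genusX0_le_one (hg : genusX0 N ≤ 1)
    (hf : IsNewform0 f) : finrank_cuspForm_two_eq_genusX0 N :=
  Literature.NumberTheory.EllipticCurves.ModularForms.finrank_cuspForm_two_eq_genusX0_of_genusX0_le_one hg hf.ne_zero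

/-- The same for the genus-cum-dimension form `twelve_mul_finrank_cuspForm_two (Gamma0 N)`
(Diamond–Shurman Thm. 3.5.1 with Thm. 3.1.1).
[cite: DiamondShurman2005, Thm. 3.5.1 with Thm. 3.1.1] -/
theorem IsNewform0.twelve_mul_finrank_cuspForm_two_of_genusX0_le_one (hg : genusX0 N ≤ 1)
    (hf : IsNewform0 f) : twelve_mul_finrank_cuspForm_two (Gamma0 N) :=
  twelve_mul_finrank_cuspForm_two_gamma0_of_genusX0_le_one hg hf.ne_zero

/-- **`IsNewform0.exists_rat_smul_minusPeriod` holds outright at every level of genus `≤ 1`**: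
a newform `f` is a nonzero weight-`2` cusp form (`IsNewform0.ne_zero`), so
`dim S₂(Γ₀(N)) ≥ 1 ≥ genusX0 N` and `IsNewform0.exists_rat_smul_minusPeriod_of_genusX0_le`
applies (at genus `0` the statement is vacuous: `S₂(Γ₀(N)) = 0` has no newform).
[cite: Manin1972, Thm. 3.5 and Cor. 3.6] -/
theorem IsNewform0.exists_rat_smul_minusPeriod_of_genusX0_le_one (hg : genusX0 N ≤ 1) :
    IsNewform0.exists_rat_smul_minusPeriod (f := f) := fun hf hQ ↦
  IsNewform0.exists_rat_smul_minusPeriod_of_genus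
    (twelve_mul_finrank_cuspForm_two_gamma0_of_genusX0_le_one hg hf.ne_zero) hf hQ

end Reduction

/-! ### The levels of genus at most one -/

section Levels

/-- `μ(Γ₀(17)) = 18`, `ν_∞(Γ₀(17)) = 2`, `ν₂(Γ₀(17)) = 2`, `ν₃(Γ₀(17)) = 0`
(Diamond–Shurman Figure 3.3, Cor. 3.7.2, §3.8). [folklore] -/
theorem gamma0_data_17 :
    gamma0Index 17 = 18 ∧ nuInfty 17 = 2 ∧ nu₂ 17 = 2 ∧ nu₃ 17 = 0 :=
  ⟨gamma0Index_prime (by norm_num),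
    by decide, by rw [nu₂_eq_card]; decide, by rw [nu₃_eq_card]; decide⟩

/-- `μ(Γ₀(19)) = 20`, `ν_∞(Γ₀(19)) = 2`, `ν₂(Γ₀(19)) = 0`, `ν₃(Γ₀(19)) = 2`
(Diamond–Shurman Figure 3.3, Cor. 3.7.2, §3.8). [folklore] -/
theorem gamma0_data_19 :
    gamma0Index 19 = 20 ∧ nuInfty 19 = 2 ∧ nu₂ 19 = 0 ∧ nu₃ 19 = 2 :=
  ⟨gamma0Index_prime (by norm_num),
    by decide, by rw [nu₂_eq_card]; decide, by rw [nu₃_eq_card]; decide⟩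

/-- `μ(Γ₀(21)) = 32`, `ν_∞(Γ₀(21)) = 4`, `ν₂(Γ₀(21)) = 0`, `ν₃(Γ₀(21)) = 2`
(Diamond–Shurman Figure 3.3, Cor. 3.7.2, §3.8). [folklore] -/
theorem gamma0_data_21 :
    gamma0Index 21 = 32 ∧ nuInfty 21 = 4 ∧ nu₂ 21 = 0 ∧ nu₃ 21 = 2 :=
  ⟨(gamma0Index_mul (m := 3) (n := 7) (by norm_num)).trans
      (by rw [gamma0Index_prime Nat.prime_three, gamma0Index_prime (by norm_num : Nat.Prime 7)]),
    by decide, by rw [nu₂_eq_card]; decide, by rw [nu₃_eq_card]; decide⟩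

/-- `μ(Γ₀(49)) = 56`, `ν_∞(Γ₀(49)) = 8`, `ν₂(Γ₀(49)) = 0`, `ν₃(Γ₀(49)) = 2`
(Diamond–Shurman Cor. 3.7.2, §3.8, Ex. 3.1.4). [folklore] -/
theorem gamma0_data_49 :
    gamma0Index 49 = 56 ∧ nuInfty 49 = 8 ∧ nu₂ 49 = 0 ∧ nu₃ 49 = 2 :=
  ⟨gamma0Index_prime_pow (p := 7) (e := 2) (by norm_num) two_ne_zero,
    by decide, by rw [nu₂_eq_card]; decide, by rw [nu₃_eq_card]; decide⟩

/-- **The twenty-seven levels of genus `≤ 1`**: `genusX0 N ≤ 1` for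
`N ∈ {1, …, 21, 24, 25, 27, 32, 36, 49}` — genus `0` for `N ∈ {1, …, 10, 12, 13, 16, 18, 25}` and
genus `1` for `N ∈ {11, 14, 15, 17, 19, 20, 21, 24, 27, 32, 36, 49}`, from the data `μ, ν_∞, ν₂, ν₃`
(Diamond–Shurman Thm. 3.1.1 with the data of §3.9, Figure 3.3, and Ex. 3.1.4; the classical
genus-`0` and genus-`1` levels, cf. Cremona 1997, Table 1, which starts at `N = 11`).
[cite: DiamondShurman2005, Thm. 3.1.1 with Figure 3.3] -/
theorem genusX0_le_one_of_mem {N : ℕ}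
    (hN : N ∈ ({1, 2, 3, 4, 5, 6, 7, 8, 9, 10, 11, 12, 13, 14, 15, 16, 17, 18, 19, 20, 21, 24, 25,
      27, 32, 36, 49} : Finset ℕ)) :
    genusX0 N ≤ 1 := by
  simp only [Finset.mem_insert, Finset.mem_singleton] at hN
  rcases hN with rfl | rfl | rfl | rfl | rfl | rfl | rfl | rfl | rfl | rfl | rfl | rfl | rfl |
    rfl | rfl | rfl | rfl | rfl | rfl | rfl | rfl | rfl | rfl | rfl | rfl | rfl | rfl
  · obtain ⟨hμ, hν, h₂, h₃⟩ := gamma0_data_1; norm_num [genusX0, hμ, hν, h₂, h₃]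
  · obtain ⟨hμ, hν, h₂, h₃⟩ := gamma0_data_2; norm_num [genusX0, hμ, hν, h₂, h₃]
  · obtain ⟨hμ, hν, h₂, h₃⟩ := gamma0_data_3; norm_num [genusX0, hμ, hν, h₂, h₃]
  · obtain ⟨hμ, hν, h₂, h₃⟩ := gamma0_data_4; norm_num [genusX0, hμ, hν, h₂, h₃]
  · obtain ⟨hμ, hν, h₂, h₃⟩ := gamma0_data_5; norm_num [genusX0, hμ, hν, h₂, h₃]
  · obtain ⟨hμ, hν, h₂, h₃⟩ := gamma0_data_6; norm_num [genusX0, hμ, hν, h₂, h₃]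
  · obtain ⟨hμ, hν, h₂, h₃⟩ := gamma0_data_7; norm_num [genusX0, hμ, hν, h₂, h₃]
  · obtain ⟨hμ, hν, h₂, h₃⟩ := gamma0_data_8; norm_num [genusX0, hμ, hν, h₂, h₃]
  · obtain ⟨hμ, hν, h₂, h₃⟩ := gamma0_data_9; norm_num [genusX0, hμ, hν, h₂, h₃]
  · obtain ⟨hμ, hν, h₂, h₃⟩ := gamma0_data_10; norm_num [genusX0, hμ, hν, h₂, h₃]
  · obtain ⟨hμ, hν, h₂, h₃⟩ := gamma0_data_11; norm_num [genusX0, hμ, hν, h₂, h₃]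
  · obtain ⟨hμ, hν, h₂, h₃⟩ := gamma0_data_12; norm_num [genusX0, hμ, hν, h₂, h₃]
  · obtain ⟨hμ, hν, h₂, h₃⟩ := gamma0_data_13; norm_num [genusX0, hμ, hν, h₂, h₃]
  · obtain ⟨hμ, hν, h₂, h₃⟩ := gamma0_data_14; norm_num [genusX0, hμ, hν, h₂, h₃]
  · obtain ⟨hμ, hν, h₂, h₃⟩ := gamma0_data_15; norm_num [genusX0, hμ, hν, h₂, h₃]
  · obtain ⟨hμ, hν, h₂, h₃⟩ := gamma0_data_16; norm_num [genusX0, hμ, hν, h₂, h₃]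
  · obtain ⟨hμ, hν, h₂, h₃⟩ := gamma0_data_17; norm_num [genusX0, hμ, hν, h₂, h₃]
  · obtain ⟨hμ, hν, h₂, h₃⟩ := gamma0_data_18; norm_num [genusX0, hμ, hν, h₂, h₃]
  · obtain ⟨hμ, hν, h₂, h₃⟩ := gamma0_data_19; norm_num [genusX0, hμ, hν, h₂, h₃]
  · obtain ⟨hμ, hν, h₂, h₃⟩ := gamma0_data_20; norm_num [genusX0, hμ, hν, h₂, h₃]
  · obtain ⟨hμ, hν, h₂, h₃⟩ := gamma0_data_21; norm_num [genusX0, hμ, hν, h₂, h₃]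
  · obtain ⟨hμ, hν, h₂, h₃⟩ := gamma0_data_24; norm_num [genusX0, hμ, hν, h₂, h₃]
  · obtain ⟨hμ, hν, h₂, h₃⟩ := gamma0_data_25; norm_num [genusX0, hμ, hν, h₂, h₃]
  · obtain ⟨hμ, hν, h₂, h₃⟩ := gamma0_data_27; norm_num [genusX0, hμ, hν, h₂, h₃]
  · obtain ⟨hμ, hν, h₂, h₃⟩ := gamma0_data_32; norm_num [genusX0, hμ, hν, h₂, h₃]
  · obtain ⟨hμ, hν, h₂, h₃⟩ := gamma0_data_36; norm_num [genusX0, hμ, hν, h₂, h₃]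
  · obtain ⟨hμ, hν, h₂, h₃⟩ := gamma0_data_49; norm_num [genusX0, hμ, hν, h₂, h₃]

/-- **`IsNewform0.exists_rat_smul_minusPeriod` holds outright for
`N ∈ {1, …, 21, 24, 25, 27, 32, 36, 49}`** (the levels with `genusX0 N ≤ 1` of
`genusX0_le_one_of_mem`; among them the twelve genus-one levels
`11, 14, 15, 17, 19, 20, 21, 24, 27, 32, 36, 49` of the first rational newforms, Cremona 1997,
Table 1): for a normalised newform `f ∈ S₂(Γ₀(N))` with rational coefficients at
such a level, `Ω⁻_f ≠ 0` and `im (minusSymbol f r) ∈ ℚ · Ω⁻_f` for all `r ∈ ℚ`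
(Manin 1972, Thm. 3.5 and Cor. 3.6). [cite: Manin1972, Thm. 3.5 and Cor. 3.6] -/
theorem IsNewform0.exists_rat_smul_minusPeriod_of_mem {N : ℕ} [NeZero N]
    (hN : N ∈ ({1, 2, 3, 4, 5, 6, 7, 8, 9, 10, 11, 12, 13, 14, 15, 16, 17, 18, 19, 20, 21, 24, 25,
      27, 32, 36, 49} : Finset ℕ))
    {f : CuspForm (Gamma0 N) 2} : IsNewform0.exists_rat_smul_minusPeriod (f := f) :=
  IsNewform0.exists_rat_smul_minusPeriod_of_genusX0_le_one (genusX0_le_one_of_mem hN)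

end Levels

end Literature.NumberTheory.EllipticCurves.ModularForms

end
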